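import Mathlib
import Literature.Combinatorics.Optimization.LocalIsing
import HarnessLib

/-!
# The Ising ground state with a magnetic field is a maximum cut (Barahona–Grötschel–Jünger–Reinelt)

Topic `Literature/Combinatorics/Optimization`.  Source: F. Barahona, M. Grötschel, M. Jünger,
G. Reinelt, *An application of combinatorial optimization to statistical physics and circuit layout
design*, Operations Research **36** (1988) 493–513, §1 ("Ground states of spin glasses"): for the
Hamiltonian `H(ω) = −Σ_{ij ∈ E} J_ij S_i S_j − h Σ_i S_i`, `S_i ∈ {+1, −1}`, one adds a vertex `0`
joined to every spin `i` with interaction `J_{0i} = h` and sets `S_0 = +1`; on the enlarged graph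
`G₀ = (V₀, E₀)`, with `V⁺ = {i : S_i = +1}`, the energy of a configuration is
`H = −Σ_{ij ∈ E₀} J_ij + 2 Σ_{ij ∈ δ(V⁺)} J_ij` — a constant plus twice the weight of the cut `δ(V⁺)` —
so that "the problem of finding a ground state is equivalent to finding a maximum cut in `G₀`" with
edge weights `c_ij = −J_ij` [BarahonaEtAl1988, §1]; the same one-extra-vertex device turns unconstrained quadratic 0–1 minimisation (QUBO) into
max-cut (ibid., §1, via `x_i = (1 − S_i)/2`; P. L. Hammer 1965; E. Boros, P. L. Hammer,
*Pseudo-Boolean optimization*, Discrete Appl. Math. 123 (2002) §2, max-cut as the quadratic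
pseudo-Boolean maximisation of `Σ_{ij ∈ E} (x_i x̄_j + x̄_i x_j)` [BorosHammer2002]).

HONEST FRAMING (pub-qadeq lane context — the QUBO / Ising / Max-Cut rows A-240 (123-qubit
hydration-site QUBO vs ‘exact classical solvers’), A-204 / A-200 / A-191 (few-qubit and qudit QAOA
Max-(k-)Cut), A-33 / A-75 (QAOA weighted Max-Cut), E-73 (coherent Ising machines), E-42 (HUBO):
every ‘QUBO solver’ claim is a weighted Max-Cut claim on one more vertex and conversely, so the
classical Max-Cut literature (exact branch-and-cut, Goemans–Williamson, the Erdős `|E|/2` baseline of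
`RandomCutBaseline.lean`) is the comparator class by a theorem, not by analogy): instance-level
adjudication of specific advantage claims; no claim about BQP vs BPP or the summit.  This file proves
the identity itself; it asserts nothing about any algorithm or device.

Design.  Spins are Boolean-coded as in `LocalIsing` (same directory; `spin σ i = ±1`).  Couplings are
a dense integer array `J : Fin N → Fin N → ℤ` read on the pairs `i < j` only (so neither symmetry nor
a zero diagonal is assumed); fields are `h : Fin N → ℤ`.  We use the sign convention
`E(σ) = Σ_{i<j} J_ij s_i s_j + Σ_i h_i s_i` (BGJR's `H` is `E` with `J ↦ −J`, `h ↦ −h`; the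
identities below are sign-agnostic).  The cut weight of a two-colouring `Y` is
`cut_J(Y) = Σ_{i<j, Y_i ≠ Y_j} J_ij`.

## Contents (all proved, 0 named facts)

* `pairEnergy`, `totalWeight`, `cutWeight`; **`pairEnergy_eq_totalWeight_sub_two_mul_cutWeight`** —
  `Σ_{i<j} J_ij s_i s_j = Σ_{i<j} J_ij − 2·cut_J(σ)` [cite: BarahonaEtAl1988, §1
  (H = −Σ J_ij + 2 Σ_{δ(V⁺)} J_ij)].
* `minPairEnergy`, `maxCutWeight`; **`minPairEnergy_eq`** — `min_σ Σ_{i<j} J_ij s_i s_j =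
  Σ_{i<j} J_ij − 2·maxcut_J` ("finding a ground state is equivalent to finding a maximum cut")
  [cite: BarahonaEtAl1988, §1].
* `fieldEnergy`, `augment` (the extra vertex `0` with `J_{0i} = h_i`), `pairEnergy_augment_cons_true`
  (`S_0 = +1` recovers the field term), `pairEnergy_not` (global spin-flip invariance),
  **`minFieldEnergy_eq_minPairEnergy_augment`** and **`minFieldEnergy_eq`** — the ground-state energy
  with a field equals `Σ_{E₀} J − 2·maxcut_J(G₀)` on the enlarged graph
  [cite: BarahonaEtAl1988, §1 (vertex 0, S_0 = +1)].
* `quboValue`, **`four_mul_quboValue_eq`** — the QUBO ↔ Ising-with-field dictionary under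
  `x_i = (1 − s_i)/2`: `4·(Σ_i a_i x_i + Σ_{i<j} b_ij x_i x_j) = c + Σ_i h_i s_i + Σ_{i<j} b_ij s_i s_j`
  with `c = 2Σ a + Σ b`, `h_i = −2a_i − Σ_{j : i<j} b_ij − Σ_{j : j<i} b_ji`
  [cite: BarahonaEtAl1988, §1 (x_i = (1 − S_i)/2)] [cite: BorosHammer2002, §2].
* Two toy `decide` certificates (frustrated triangle; two spins with a field) showing that the
  definitions evaluate in the kernel.

## References
* [BarahonaEtAl1988] F. Barahona, M. Grötschel, M. Jünger, G. Reinelt, An application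
  of combinatorial optimization to statistical physics and circuit layout design, Oper. Res. 36 (1988)
  493–513, doi:10.1287/opre.36.3.493, §1.
* [BorosHammer2002] E. Boros, P. L. Hammer, Pseudo-Boolean optimization, Discrete Appl. Math. 123
  (2002) 155–225, doi:10.1016/S0166-218X(01)00341-9, §2.
* [Barahona1982] F. Barahona, On the computational complexity of Ising spin glass models, J. Phys. A 15
  (1982) 3241–3253 (NP-hardness of the ground state with a field; context only).
-/

namespace Literature.Combinatorics.Optimization

namespace IsingMaxCut

open Finset LocalIsing

variable {N : ℕ}

/-! ### Pair energy, total weight, cut weight -/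

/-- The two-body (field-free) Ising energy `Σ_{i<j} J_ij s_i(σ) s_j(σ)` of a dense coupling array read
on the pairs `i < j`. [cite: BarahonaEtAl1988, §1 (H(ω) = −Σ J_ij S_i S_j, field-free part)] -/
def pairEnergy (J : Fin N → Fin N → ℤ) (σ : Fin N → Bool) : ℤ :=
  ∑ i, ∑ j, if i < j then J i j * spin σ i * spin σ j else 0

/-- The total weight `Σ_{i<j} J_ij`. [cite: BarahonaEtAl1988, §1 (the constant −Σ_{ij∈E} J_ij)] -/
def totalWeight (J : Fin N → Fin N → ℤ) : ℤ :=
  ∑ i, ∑ j, if i < j then J i j else 0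

/-- The weight of the cut defined by a two-colouring `Y`: `Σ_{i<j, Y_i ≠ Y_j} J_ij` (the edges with
exactly one endpoint in `V⁺ = {i : Y_i}`). [cite: BarahonaEtAl1988, §1 (Σ_{ij ∈ δ(V⁺)} J_ij)] -/
def cutWeight (J : Fin N → Fin N → ℤ) (Y : Fin N → Bool) : ℤ :=
  ∑ i, ∑ j, if i < j ∧ Y i ≠ Y j then J i j else 0

/-- `s_i s_j = +1` if the two spins agree and `−1` otherwise. [folklore] -/
private theorem spin_mul_spin (σ : Fin N → Bool) (i j : Fin N) :
    spin σ i * spin σ j = if σ i = σ j then 1 else -1 := by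
  unfold spin
  cases σ i <;> cases σ j <;> simp

/-- **BGJR's identity**: `Σ_{i<j} J_ij s_i s_j = Σ_{i<j} J_ij − 2 · Σ_{i<j, σ_i ≠ σ_j} J_ij` — the pair
energy is the total weight minus twice the weight of the cut between the `+` and `−` spins.
[cite: BarahonaEtAl1988, §1 (H = −Σ_{ij∈E₀} J_ij + 2 Σ_{ij∈δ(V⁺)} J_ij)] -/
theorem pairEnergy_eq_totalWeight_sub_two_mul_cutWeight (J : Fin N → Fin N → ℤ) (σ : Fin N → Bool) :
    pairEnergy J σ = totalWeight J - 2 * cutWeight J σ := by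
  unfold pairEnergy totalWeight cutWeight
  rw [mul_sum, ← sum_sub_distrib]
  refine sum_congr rfl fun i _ => ?_
  rw [mul_sum, ← sum_sub_distrib]
  refine sum_congr rfl fun j _ => ?_
  by_cases hij : i < j
  · rw [mul_assoc, spin_mul_spin]
    by_cases hs : σ i = σ j
    · simp [hij, hs]
    · simp [hij, hs]; ring
  · simp [hij]

/-! ### Ground state = maximum cut -/

/-- The ground-state (minimum) pair energy over all `2^N` configurations.
[cite: BarahonaEtAl1988, §1 (ground state = configuration of minimum energy)] -/
def minPairEnergy (J : Fin N → Fin N → ℤ) : ℤ :=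
  (univ : Finset (Fin N → Bool)).inf' ⟨fun _ => true, mem_univ _⟩ (pairEnergy J)

/-- The maximum cut weight `max_Y cut_J(Y)` over all two-colourings.
[cite: BarahonaEtAl1988, §1 (max-cut problem)] -/
def maxCutWeight (J : Fin N → Fin N → ℤ) : ℤ :=
  (univ : Finset (Fin N → Bool)).sup' ⟨fun _ => true, mem_univ _⟩ (cutWeight J)

/-- Every cut weighs at most the maximum cut. [folklore] -/
private theorem cutWeight_le_maxCutWeight (J : Fin N → Fin N → ℤ) (Y : Fin N → Bool) :
    cutWeight J Y ≤ maxCutWeight J :=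
  le_sup' (cutWeight J) (mem_univ Y)

/-- The maximum cut is attained. [folklore] -/
private theorem exists_cutWeight_eq_maxCutWeight (J : Fin N → Fin N → ℤ) :
    ∃ Y : Fin N → Bool, cutWeight J Y = maxCutWeight J := by
  obtain ⟨Y, -, hY⟩ := exists_mem_eq_sup' (s := (univ : Finset (Fin N → Bool)))
    ⟨fun _ => true, mem_univ _⟩ (cutWeight J)
  exact ⟨Y, hY.symm⟩

/-- The minimum pair energy is a lower bound. [folklore] -/
private theorem minPairEnergy_le (J : Fin N → Fin N → ℤ) (σ : Fin N → Bool) :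
    minPairEnergy J ≤ pairEnergy J σ :=
  inf'_le (pairEnergy J) (mem_univ σ)

/-- The minimum pair energy is attained. [folklore] -/
private theorem exists_pairEnergy_eq_minPairEnergy (J : Fin N → Fin N → ℤ) :
    ∃ σ : Fin N → Bool, pairEnergy J σ = minPairEnergy J := by
  obtain ⟨σ, -, hσ⟩ := exists_mem_eq_inf' (s := (univ : Finset (Fin N → Bool)))
    ⟨fun _ => true, mem_univ _⟩ (pairEnergy J)
  exact ⟨σ, hσ.symm⟩

/-- **Ground state = maximum cut** (field-free case): `min_σ Σ_{i<j} J_ij s_i s_j = Σ_{i<j} J_ij −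
2 · maxcut_J`, and a configuration is a ground state iff its `±` bipartition is a maximum cut.
[cite: BarahonaEtAl1988, §1 ("the problem of finding a ground state … is equivalent to
finding a maximum cut")] -/
theorem minPairEnergy_eq (J : Fin N → Fin N → ℤ) :
    minPairEnergy J = totalWeight J - 2 * maxCutWeight J := by
  apply le_antisymm
  · obtain ⟨Y, hY⟩ := exists_cutWeight_eq_maxCutWeight J
    calc minPairEnergy J ≤ pairEnergy J Y := minPairEnergy_le J Y
      _ = totalWeight J - 2 * maxCutWeight J := by
        rw [pairEnergy_eq_totalWeight_sub_two_mul_cutWeight, hY]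
  · obtain ⟨σ, hσ⟩ := exists_pairEnergy_eq_minPairEnergy J
    rw [← hσ, pairEnergy_eq_totalWeight_sub_two_mul_cutWeight]
    have := cutWeight_le_maxCutWeight J σ
    linarith

/-- A configuration is a ground state of the pair energy iff its bipartition is a maximum cut.
[cite: BarahonaEtAl1988, §1] -/
theorem pairEnergy_eq_min_iff (J : Fin N → Fin N → ℤ) (σ : Fin N → Bool) :
    pairEnergy J σ = minPairEnergy J ↔ cutWeight J σ = maxCutWeight J := by
  rw [minPairEnergy_eq, pairEnergy_eq_totalWeight_sub_two_mul_cutWeight]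
  constructor
  · intro h; linarith
  · intro h; rw [h]

/-! ### The magnetic field as one extra vertex -/

/-- The Ising energy with a magnetic field: `Σ_{i<j} J_ij s_i s_j + Σ_i h_i s_i`.
[cite: BarahonaEtAl1988, §1 (H(ω) = −Σ J_ij S_i S_j − h Σ S_i; site-dependent h_i allowed here)] -/
def fieldEnergy (J : Fin N → Fin N → ℤ) (h : Fin N → ℤ) (σ : Fin N → Bool) : ℤ :=
  pairEnergy J σ + ∑ i, h i * spin σ i

/-- The ground-state energy with a field. [cite: BarahonaEtAl1988, §1] -/
def minFieldEnergy (J : Fin N → Fin N → ℤ) (h : Fin N → ℤ) : ℤ :=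
  (univ : Finset (Fin N → Bool)).inf' ⟨fun _ => true, mem_univ _⟩ (fieldEnergy J h)

/-- The enlarged coupling array on `N + 1` spins: a new vertex `0` joined to every spin `i` with
coupling `J_{0,i+1} = h_i`, the old couplings shifted to `(i+1, j+1)` (entries with first index `≥`
second are never read). [cite: BarahonaEtAl1988, §1 ("we introduce a new vertex 0 … J_{0i} = h")] -/
def augment (J : Fin N → Fin N → ℤ) (h : Fin N → ℤ) : Fin (N + 1) → Fin (N + 1) → ℤ :=
  Fin.cases (Fin.cases 0 h) fun i => Fin.cases 0 (J i)

/-- Reading the enlarged array on the pairs `(0, j+1)` gives the field `h_j` (plumbing). [folklore] -/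
@[simp] private theorem augment_zero_succ (J : Fin N → Fin N → ℤ) (h : Fin N → ℤ) (j : Fin N) :
    augment J h 0 j.succ = h j := by
  simp [augment]

/-- Reading the enlarged array on the pairs `(i+1, j+1)` gives `J_ij` (plumbing). [folklore] -/
@[simp] private theorem augment_succ_succ (J : Fin N → Fin N → ℤ) (h : Fin N → ℤ) (i j : Fin N) :
    augment J h i.succ j.succ = J i j := by
  simp [augment]

/-- The spin of the new vertex `0` (plumbing). [folklore] -/
@[simp] private theorem spin_cons_zero (b : Bool) (σ : Fin N → Bool) :
    spin (Fin.cons b σ : Fin (N + 1) → Bool) 0 = if b then 1 else -1 := by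
  simp [spin]

/-- The spins of the old vertices are unchanged (plumbing). [folklore] -/
@[simp] private theorem spin_cons_succ (b : Bool) (σ : Fin N → Bool) (i : Fin N) :
    spin (Fin.cons b σ : Fin (N + 1) → Bool) i.succ = spin σ i := by
  simp [spin]

/-- With the extra spin set to `S_0 = +1`, the pair energy of the enlarged system is the field energy:
`Σ_{i<j ≤ N} J'_ij s_i s_j = Σ_{i<j} J_ij s_i s_j + Σ_i h_i s_i`.
[cite: BarahonaEtAl1988, §1 (S_0 = +1)] -/
theorem pairEnergy_augment_cons_true (J : Fin N → Fin N → ℤ) (h : Fin N → ℤ) (σ : Fin N → Bool) :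
    pairEnergy (augment J h) (Fin.cons true σ) = fieldEnergy J h σ := by
  unfold pairEnergy fieldEnergy
  rw [Fin.sum_univ_succ]
  simp only [Fin.sum_univ_succ, lt_self_iff_false, if_false, Fin.succ_pos, if_true, Fin.not_lt_zero,
    Fin.succ_lt_succ_iff, augment_zero_succ, augment_succ_succ, spin_cons_zero, spin_cons_succ,
    zero_add, mul_one]
  unfold pairEnergy
  ring

/-- Global spin flip leaves every pair energy invariant (`(−s_i)(−s_j) = s_i s_j`). [folklore] -/
private theorem pairEnergy_not {M : ℕ} (J : Fin M → Fin M → ℤ) (τ : Fin M → Bool) :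
    pairEnergy J (fun i => !τ i) = pairEnergy J τ := by
  unfold pairEnergy
  refine sum_congr rfl fun i _ => sum_congr rfl fun j _ => ?_
  simp only [spin_not]
  split <;> ring

/-- Every configuration of the enlarged system has the pair energy of a field configuration of the
original one (flip globally so that `S_0 = +1`, then drop vertex `0`). [cite: BarahonaEtAl1988, §1
("we may assume S_0 = +1")] -/
theorem exists_fieldEnergy_eq_pairEnergy_augment (J : Fin N → Fin N → ℤ) (h : Fin N → ℤ)
    (τ : Fin (N + 1) → Bool) : ∃ σ : Fin N → Bool, fieldEnergy J h σ = pairEnergy (augment J h) τ := by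
  cases hτ : τ 0
  · refine ⟨fun i => !τ i.succ, ?_⟩
    rw [← pairEnergy_not, ← pairEnergy_augment_cons_true]
    congr 1
    ext i
    refine Fin.cases ?_ (fun k => ?_) i
    · simp [hτ]
    · simp
  · refine ⟨fun i => τ i.succ, ?_⟩
    rw [← pairEnergy_augment_cons_true]
    congr 1
    ext i
    refine Fin.cases ?_ (fun k => ?_) i
    · simp [hτ]
    · simp

/-- **The field is one more vertex**: the ground-state energy with a magnetic field equals the
field-free ground-state energy of the enlarged system `G₀`.
[cite: BarahonaEtAl1988, §1 (reduction to G₀ = (V ∪ {0}, E ∪ {0i}))] -/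
theorem minFieldEnergy_eq_minPairEnergy_augment (J : Fin N → Fin N → ℤ) (h : Fin N → ℤ) :
    minFieldEnergy J h = minPairEnergy (augment J h) := by
  apply le_antisymm
  · obtain ⟨τ, hτ⟩ := exists_pairEnergy_eq_minPairEnergy (augment J h)
    obtain ⟨σ, hσ⟩ := exists_fieldEnergy_eq_pairEnergy_augment J h τ
    calc minFieldEnergy J h ≤ fieldEnergy J h σ := inf'_le (fieldEnergy J h) (mem_univ σ)
      _ = minPairEnergy (augment J h) := by rw [hσ, hτ]
  · obtain ⟨σ, -, hσ⟩ := exists_mem_eq_inf' (s := (univ : Finset (Fin N → Bool)))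
      ⟨fun _ => true, mem_univ _⟩ (fieldEnergy J h)
    change minFieldEnergy J h = _ at hσ
    rw [hσ, ← pairEnergy_augment_cons_true]
    exact minPairEnergy_le _ _

/-- **BGJR's reduction, end to end**: the ground-state energy of `Σ_{i<j} J_ij s_i s_j + Σ_i h_i s_i`
is `Σ_{E₀} J' − 2 · maxcut_{J'}(G₀)` for the enlarged graph `G₀` (vertex `0` carrying the fields) —
"finding a ground state in a magnetic field is a max-cut problem on `G₀`".
[cite: BarahonaEtAl1988, §1] -/
theorem minFieldEnergy_eq (J : Fin N → Fin N → ℤ) (h : Fin N → ℤ) :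
    minFieldEnergy J h = totalWeight (augment J h) - 2 * maxCutWeight (augment J h) := by
  rw [minFieldEnergy_eq_minPairEnergy_augment, minPairEnergy_eq]

/-- The total weight of the enlarged system is `Σ_{i<j} J_ij + Σ_i h_i`. [folklore] -/
private theorem totalWeight_augment (J : Fin N → Fin N → ℤ) (h : Fin N → ℤ) :
    totalWeight (augment J h) = totalWeight J + ∑ i, h i := by
  unfold totalWeight
  rw [Fin.sum_univ_succ]
  simp only [Fin.sum_univ_succ, lt_self_iff_false, if_false, Fin.succ_pos, if_true, Fin.not_lt_zero,
    Fin.succ_lt_succ_iff, augment_zero_succ, augment_succ_succ, zero_add]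
  ring

/-! ### QUBO ↔ Ising with a field (`x_i = (1 − s_i)/2`) -/

/-- The strictly-upper-triangular reading `[i < j] · b_ij` of a dense array (plumbing). [folklore] -/
def upper (b : Fin N → Fin N → ℤ) (i j : Fin N) : ℤ := if i < j then b i j else 0

/-- A quadratic pseudo-Boolean (QUBO) objective `Σ_i a_i x_i + Σ_{i<j} b_ij x_i x_j` evaluated at the
`{0,1}` vector `x = bit σ` (`x_i = (1 − s_i)/2`, `LocalIsing.bit`).
[cite: BorosHammer2002, §2 (quadratic pseudo-Boolean functions)] -/
def quboValue (a : Fin N → ℤ) (b : Fin N → Fin N → ℤ) (σ : Fin N → Bool) : ℤ :=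
  ∑ i, a i * bit σ i + ∑ i, ∑ j, if i < j then b i j * bit σ i * bit σ j else 0

/-- The induced fields `h_i = −2a_i − Σ_{j : i<j} b_ij − Σ_{j : j<i} b_ji` of the QUBO → Ising dictionary.
[cite: BarahonaEtAl1988, §1 (substitution x_i = (1 − S_i)/2)] -/
def quboField (a : Fin N → ℤ) (b : Fin N → Fin N → ℤ) (i : Fin N) : ℤ :=
  -2 * a i - ∑ j, (upper b i j + upper b j i)

/-- **QUBO = Ising with a field, up to the factor 4 and a constant**: under `x_i = (1 − s_i)/2`,
`4 · (Σ_i a_i x_i + Σ_{i<j} b_ij x_i x_j) = (2 Σ_i a_i + Σ_{i<j} b_ij) + Σ_{i<j} b_ij s_i s_j + Σ_i h_i s_i`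
with `h = quboField a b`; hence QUBO minimisation in `n` variables is, by `minFieldEnergy_eq`, a
max-cut problem on `n + 1` vertices. [cite: BarahonaEtAl1988, §1 (quadratic 0–1
programming reduces to max-cut via x_i = (1 − S_i)/2)] [cite: BorosHammer2002, §2] -/
theorem four_mul_quboValue_eq (a : Fin N → ℤ) (b : Fin N → Fin N → ℤ) (σ : Fin N → Bool) :
    4 * quboValue a b σ = (2 * ∑ i, a i + totalWeight b) + fieldEnergy b (quboField a b) σ := by
  have hbit : ∀ i, (2 : ℤ) * bit σ i = 1 - spin σ i := two_mul_bit_eq σ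
  -- (1) the left-hand side in the spins
  have h1 : 4 * quboValue a b σ = ∑ i, 2 * a i * (1 - spin σ i)
      + ∑ i, ∑ j, upper b i j * ((1 - spin σ i) * (1 - spin σ j)) := by
    unfold quboValue
    rw [mul_add, mul_sum, mul_sum]
    congr 1
    · refine sum_congr rfl fun i _ => ?_
      rw [← hbit i]; ring
    · refine sum_congr rfl fun i _ => ?_
      rw [mul_sum]
      refine sum_congr rfl fun j _ => ?_
      unfold upper
      split
      · rw [← hbit i, ← hbit j]; ring
      · simp
  -- (2) expand the product
  have h2 : ∑ i, ∑ j, upper b i j * ((1 - spin σ i) * (1 - spin σ j))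
      = ∑ i, ∑ j, upper b i j - ∑ i, ∑ j, upper b i j * spin σ i - ∑ i, ∑ j, upper b i j * spin σ j
        + ∑ i, ∑ j, upper b i j * (spin σ i * spin σ j) := by
    simp only [← sum_sub_distrib, ← sum_add_distrib]
    refine sum_congr rfl fun i _ => sum_congr rfl fun j _ => ?_
    ring
  -- (3) exchange the order of summation in the `s_j` cross term
  have h3 : ∑ i, ∑ j, upper b i j * spin σ j = ∑ i, ∑ j, upper b j i * spin σ i := by
    rw [sum_comm]
  -- (4) the field term
  have h4 : ∑ i, quboField a b i * spin σ i
      = ∑ i, (-2) * a i * spin σ i - ∑ i, ∑ j, upper b i j * spin σ i - ∑ i, ∑ j, upper b j i * spin σ i := by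
    simp only [← sum_sub_distrib]
    refine sum_congr rfl fun i _ => ?_
    have hq : quboField a b i = -2 * a i - (∑ j, upper b i j) - ∑ j, upper b j i := by
      rw [quboField, sum_add_distrib]; ring
    rw [hq, sub_mul, sub_mul, sum_mul, sum_mul]
  -- (5) the pair energy, the total weight and the linear term in the same shape
  have h5 : pairEnergy b σ = ∑ i, ∑ j, upper b i j * (spin σ i * spin σ j) := by
    unfold pairEnergy upper
    refine sum_congr rfl fun i _ => sum_congr rfl fun j _ => ?_
    split <;> ring
  have h6 : totalWeight b = ∑ i, ∑ j, upper b i j := rfl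
  have h7 : ∑ i, 2 * a i * (1 - spin σ i) = 2 * ∑ i, a i + ∑ i, (-2) * a i * spin σ i := by
    rw [mul_sum, ← sum_add_distrib]
    refine sum_congr rfl fun i _ => ?_
    ring
  unfold fieldEnergy
  rw [h1, h2, h3, h4, h5, h6, h7]
  ring

/-! ### Two toy kernel certificates (the definitions evaluate by `decide`; instances of experimental size
are NOT decided here) -/

/-- The frustrated antiferromagnetic triangle (`J ≡ 1`): total weight `3`, maximum cut `2`, ground-state
pair energy `3 − 2·2 = −1`. [folklore] -/
example : minPairEnergy (fun (_ : Fin 3) (_ : Fin 3) => (1 : ℤ)) = -1 ∧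
    maxCutWeight (fun (_ : Fin 3) (_ : Fin 3) => (1 : ℤ)) = 2 := by decide

/-- Two spins with `J_01 = 2` and fields `h = (3, −1)`: the ground-state energy `−6` (configuration
`(−, +)`) equals `Σ_{E₀} J' − 2·maxcut(G₀)` on the enlarged 3-vertex system, as `minFieldEnergy_eq`
states. [folklore] -/
example : minFieldEnergy (fun (_ : Fin 2) (_ : Fin 2) => (2 : ℤ)) ![3, -1] = -6 ∧
    totalWeight (augment (fun (_ : Fin 2) (_ : Fin 2) => (2 : ℤ)) ![3, -1])
      - 2 * maxCutWeight (augment (fun (_ : Fin 2) (_ : Fin 2) => (2 : ℤ)) ![3, -1]) = -6 := by decide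

end IsingMaxCut

end Literature.Combinatorics.Optimization
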